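import Mathlib.Analysis.SpecialFunctions.Pow.Real
import HarnessLib

/-!
# Route `UnitScaleTilt`, crux K1 «MinimiserStabilityRegPr» (stmt-QuantumFields-19200), EX row `hGF[Lift]` (curved member) — **LOD LINE, (L6) `hcmp`-KNIT FILE A (ABSTRACT ARITHMETIC):
# FOUR RELATIVE COMPARISON ROWS ⟹ THE PER-CUBE LOWER BOUND `(1 − θ′)·q_1 − e·n ≤ q_U`** — the real-number skeleton of w5 g13's binder
# `hcmp : (1 − θ′)·q_1(Φ_j(M_jA)) − e·‖M_jA‖² ≤ q_U(M_jA)` of ✓∕⧗`Prop7LODAssembly.curvedTarget_of_LOD_topMean`, with `q = H + (D − P) + K`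
# (Hessian + residual-Landau `‖D*A‖² − ‖P D*A‖²` + massive `a‖Q_kA‖²`), fed by (L5a) ✓p751828, (L5b) ✓p750237, (L5″) ✓p753148 and (L5c) ✓p751052 (+C).

Cell `ym3-torus` (HUMAN RULING D-0037, YM ladder rung R3 — NOT d = 4, NOT infinite volume, NOT a mass gap, NOT Clay).  Width seat `ym-routeR-w3` gen 12 («MINE hcmp-knit»
2026-08-30 00:44:48Z on ★p1 g24's CHAIR BOOK 00:40:07Z).  THEOREMS ONLY (0 `def`, 0 `sorry`), Mathlib only; `--supports stmt-QuantumFields-19200 --as helper`, count-neutral.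
HONEST LABEL (★★OWNER RULING №33 (6)): curved γ-row supplier line (LOD localisation), (L6) per-cube comparison; pure real arithmetic — nothing of (3.49), Thm 3.1∕3.3∕3.11, `h349`,
`hGF`, `hT`, EX ∕ 19200 is proved here.  The MEMBER knit (FILE B) instantiates `H_U, D_U, P_U, K_U` at `M_jA` and `H_1, D_1, P_1, K_1` at `Φ_j(M_jA)`.

THE ROWS (reals; `n = ‖M_jA‖²`; all `t_i ∈ [0,1]`, `c_i ≥ 0`):
(a) Hessian, (L5a) shape `|H_U − H_1| ≤ t₁H_U + c₁n` ⟹ used as `H_1 − c₁n ≤ (1 + t₁)H_U` with `0 ≤ H_1` (flat curl energy);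
(b) divergence, (L5b) shape `|D_U − D_1| ≤ t₂D_U + c₂n` ⟹ `D_1 − c₂n ≤ (1 + t₂)D_U`;
(p) projector, (L5″) shape `|P_U − P_1| ≤ t₃D_U + c₃n` ⟹ `P_U ≤ P_1 + t₃D_U + c₃n`, with `0 ≤ P_1 ≤ D_1` and the flat absorption `P_1 ≤ c₆n` (✓p750717 `‖P(D†A)‖ ≤ ‖A‖∕(m√a)` at `U = 1`);
(k) mass term, (L5c) shape `K_1 − c₄n ≤ (1 + t₄)K_U`, `0 ≤ K_1`.

WHAT IS PROVED (ns `Summit.QuantumFields.YangMills.Theorems.Prop7LocalComparisonArithmetic`).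
* `lower_of_relative_row` (`0 ≤ X_1`, `X_1 − cn ≤ (1+t)X_U`, `0 ≤ t` ⟹ `(1 − t)X_1 − cn ≤ X_U`), `residual_lower_of_rows` (the `D − P` piece:
  `(1 − t₂ − t₃)(D_1 − P_1) − (c₂ + c₃ + (t₂ + t₃)c₆)·n ≤ D_U − P_U`), ★★★ `localComparison_of_four_rows` (the sum: `(1 − θ′)(H_1 + (D_1 − P_1) + K_1) − e·n ≤ H_U + (D_U − P_U) + K_U`
  for every `θ′ ≥ max(t₁, t₂ + t₃, t₄)`, `θ′ ≤ 1`, `e = c₁ + c₂ + c₃ + c₄ + (t₂ + t₃)c₆`).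

References: T. Bałaban, CMP **99** (1985) 389–434 [Balaban1985BackgroundPropagators] ((3.24)–(3.27) pp.394–395, Thm 3.11 p.416).
-/

set_option autoImplicit false

namespace Summit.QuantumFields.YangMills.Theorems.Prop7LocalComparisonArithmetic

/-- **ONE RELATIVE ROW, LOWER-BOUND FORM**: `0 ≤ X_1`, `0 ≤ t`, `X_1 − c·n ≤ (1 + t)·X_U` ⟹ `(1 − t)·X_1 − c·n ≤ X_U` (`1∕(1+t) ≥ 1 − t`).
[cite: Balaban1985BackgroundPropagators, Thm 3.11 p.416] -/
theorem lower_of_relative_row {XU X1 t c n : ℝ} (hX1 : 0 ≤ X1) (ht : 0 ≤ t) (hc : 0 ≤ c) (hn : 0 ≤ n) (h : X1 - c * n ≤ (1 + t) * XU) :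
    (1 - t) * X1 - c * n ≤ XU := by
  nlinarith [mul_nonneg ht hX1, mul_nonneg ht (mul_nonneg hc hn), mul_nonneg (mul_nonneg ht ht) hX1]

/-- **THE RESIDUAL-LANDAU PIECE `D − P`**: from (b) `D_1 − c₂n ≤ (1 + t₂)D_U`, (p) `P_U ≤ P_1 + t₃D_U + c₃n`, the flat absorption `P_1 ≤ c₆n` and `0 ≤ P_1 ≤ D_1`:
**`(1 − t₂ − t₃)·(D_1 − P_1) − (c₂ + c₃ + (t₂ + t₃)c₆)·n ≤ D_U − P_U`** (`ρ := (1−t₃)∕(1+t₂) ≥ 1 − t₂ − t₃`; `ρD_1 − P_1 = ρ(D_1 − P_1) − (1−ρ)P_1`).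
[cite: Balaban1985BackgroundPropagators, (3.24)–(3.27) pp.394–395] -/
theorem residual_lower_of_rows {DU D1 PU P1 t₂ t₃ c₂ c₃ c₆ n : ℝ} (ht₂ : 0 ≤ t₂) (ht₃ : 0 ≤ t₃) (ht : t₂ + t₃ ≤ 1)
    (hc₂ : 0 ≤ c₂) (hn : 0 ≤ n) (hP1 : 0 ≤ P1) (hP1D1 : P1 ≤ D1)
    (hD : D1 - c₂ * n ≤ (1 + t₂) * DU) (hP : PU ≤ P1 + t₃ * DU + c₃ * n) (hP1n : P1 ≤ c₆ * n) :
    (1 - t₂ - t₃) * (D1 - P1) - (c₂ + c₃ + (t₂ + t₃) * c₆) * n ≤ DU - PU := by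
  have hD1 : 0 ≤ D1 := hP1.trans hP1D1
  have h13 : 0 ≤ 1 - t₃ := by linarith
  -- (p): `(1 − t₃)D_U − P_1 − c₃n ≤ D_U − P_U`
  have hmid : (1 - t₃) * DU - P1 - c₃ * n ≤ DU - PU := by nlinarith
  -- (b) scaled by `(1 − t₃)`: `(1 − t₃)(D_1 − c₂n) ≤ (1 − t₃)(1 + t₂)D_U`
  have hb : (1 - t₃) * (D1 - c₂ * n) ≤ (1 - t₃) * ((1 + t₂) * DU) := mul_le_mul_of_nonneg_left hD h13
  -- the key inequality, cleared of the denominator `1 + t₂`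
  have hkey : (1 + t₂) * ((1 - t₂ - t₃) * (D1 - P1) - (c₂ + c₃ + (t₂ + t₃) * c₆) * n) ≤ (1 + t₂) * ((1 - t₃) * DU - P1 - c₃ * n) := by
    have e1 : 0 ≤ (t₂ ^ 2 + t₂ * t₃) * D1 := by positivity
    have e2 : 0 ≤ (1 + t₂) * (t₂ + t₃) * (c₆ * n - P1) := mul_nonneg (by positivity) (by linarith)
    have e3 : 0 ≤ (t₂ + t₃) * (c₂ * n) := by positivity
    nlinarith
  have hpos : 0 < 1 + t₂ := by linarith
  have := le_of_mul_le_mul_left hkey hpos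
  linarith

/-- ★★★ **THE PER-CUBE COMPARISON FROM FOUR RELATIVE ROWS** (`q = H + (D − P) + K`): with (a) `H_1 − c₁n ≤ (1+t₁)H_U`, (b) `D_1 − c₂n ≤ (1+t₂)D_U`,
(p) `P_U ≤ P_1 + t₃D_U + c₃n`, (k) `K_1 − c₄n ≤ (1+t₄)K_U`, the flat absorption `P_1 ≤ c₆n`, signs `0 ≤ H_1, P_1, K_1`, `P_1 ≤ D_1`, `t_i, c₁, c₂, c₄ ≥ 0`, and any `θ′` with
`max(t₁, t₂ + t₃, t₄) ≤ θ′ ≤ 1`: **`(1 − θ′)·(H_1 + (D_1 − P_1) + K_1) − (c₁ + c₂ + c₃ + c₄ + (t₂ + t₃)c₆)·n ≤ H_U + (D_U − P_U) + K_U`** — w5 g13's `hcmp` with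
`e := c₁ + c₂ + c₃ + c₄ + (t₂+t₃)c₆`. [cite: Balaban1985BackgroundPropagators, (3.24)–(3.27) pp.394–395, Thm 3.11 p.416] -/
theorem localComparison_of_four_rows {HU H1 DU D1 PU P1 KU K1 t₁ t₂ t₃ t₄ θ' c₁ c₂ c₃ c₄ c₆ n : ℝ}
    (ht₁ : 0 ≤ t₁) (ht₂ : 0 ≤ t₂) (ht₃ : 0 ≤ t₃) (ht₄ : 0 ≤ t₄) (hθ₁ : t₁ ≤ θ') (hθ₂₃ : t₂ + t₃ ≤ θ') (hθ₄ : t₄ ≤ θ') (hθ' : θ' ≤ 1)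
    (hc₁ : 0 ≤ c₁) (hc₂ : 0 ≤ c₂) (hc₄ : 0 ≤ c₄) (hn : 0 ≤ n)
    (hH1 : 0 ≤ H1) (hP1 : 0 ≤ P1) (hP1D1 : P1 ≤ D1) (hK1 : 0 ≤ K1)
    (hH : H1 - c₁ * n ≤ (1 + t₁) * HU) (hD : D1 - c₂ * n ≤ (1 + t₂) * DU) (hP : PU ≤ P1 + t₃ * DU + c₃ * n) (hK : K1 - c₄ * n ≤ (1 + t₄) * KU)
    (hP1n : P1 ≤ c₆ * n) :
    (1 - θ') * (H1 + (D1 - P1) + K1) - (c₁ + c₂ + c₃ + c₄ + (t₂ + t₃) * c₆) * n ≤ HU + (DU - PU) + KU := by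
  have hHl := lower_of_relative_row hH1 ht₁ hc₁ hn hH
  have hKl := lower_of_relative_row hK1 ht₄ hc₄ hn hK
  have hRl := residual_lower_of_rows ht₂ ht₃ (hθ₂₃.trans hθ') hc₂ hn hP1 hP1D1 hD hP hP1n
  have hR1 : 0 ≤ D1 - P1 := sub_nonneg.2 hP1D1
  have e1 : (1 - θ') * H1 ≤ (1 - t₁) * H1 := mul_le_mul_of_nonneg_right (by linarith) hH1
  have e2 : (1 - θ') * (D1 - P1) ≤ (1 - t₂ - t₃) * (D1 - P1) := mul_le_mul_of_nonneg_right (by linarith) hR1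
  have e3 : (1 - θ') * K1 ≤ (1 - t₄) * K1 := mul_le_mul_of_nonneg_right (by linarith) hK1
  nlinarith

end Summit.QuantumFields.YangMills.Theorems.Prop7LocalComparisonArithmetic
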